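import Summits.BirchSwinnertonDyer.BirchSwinnertonDyer.Theorems.ResidualThetaTransportAtTwoResidualSignedLambdaLowerCMAtTwoCofreeShapiroTransport
import Summits.BirchSwinnertonDyer.BirchSwinnertonDyer.Theorems.ResidualThetaTransportAtTwoResidualSignedLambdaLowerCMAtTwoRhoLayerPairingCompat
import Literature.NumberTheory.EllipticCurves.CyclotomicLayerRhoTatePairingPk
import Literature.NumberTheory.EllipticCurves.SubgroupSelmerCocycleCriteriaProofs
import Literature.NumberTheory.EllipticCurves.Kobayashi2003.FineSelmerLeSignedSelmerProofs
import HarnessLib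

/-!
# Strictness READ-OFF at a layer: `loc_v (Sh c) = 0` ⟹ `layerLocOf_v c = 0` ⟹ every layer pairing of `c` at `v` vanishes

Route `ResidualThetaTransportAtTwo` (RTT), crux RSL_g `ResidualSignedLambdaLowerCMAtTwo` (stmt-BirchSwinnertonDyer-22608), line «onepair», S57 split
items 6 (S4₂ `stub_deepHalfAtTwoStrict`: the S-side strictness `locd_S x = 0`) and 7 (S4₀ `stub_deepHalfAwayTwo`: `locd₂ x = 0`); seat
`prover-bsd-wall-tp2-p2x-w2` g19 (`--supports`, closes nothing). THEOREMS ONLY (no definition, no named fact, no instance, no `sorry`).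
BSD is not proved by any of this; RSL_g (22608) stays OPEN.

WHY. The levelwise Poitou–Tate sockets of the deep halves (`…DeepHalfAtTwoLevelwise`, tp2-p2x LEAD g18) deliver level classes
`c ∈ H¹(Γ_n, A_ρ[p^k])` with LOCAL VANISHING of the Shapiro lift, `[strict] loc_w (Sh c) = 0` for `w ∈ S₀` (item 6) or `[p] loc_v (Sh c) = 0` at
`v ∣ p` (item 7), while the strict readings of the value transfer (`DeepHalfTransfer.locd_eq_zero_of_forall_layer_from`,
`locd₂_eq_of_forall_rhoLayerPairingPk_eq_from` with `z = 0`, p692412) consume the vanishing of the LAYER PAIRINGS `pair n (proj_n x) Q = 0`. This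
file is the brick in between, for ANY place `v` (no `v ∣ p`, no cyclotomicity needed):

* §1 **`layerLocOf_eq_zero_of_resOfLe_decomp_eq_zero`**: if `c` dies on `Γ_n ∩ D_v` (`resOfLe A_ρ[N] (Γ_n ⊓ decomp v ≤ Γ_n) c = 0`) then its
  layer localisation `layerLocOf … κ v n c ∈ H¹(U_n, A_ρ[N]|)` vanishes — the pullback along `U_n → Γ_n` factors through `Γ_n ∩ D_v`
  (`Kobayashi2003.resGalOfEmb_mem_decomp`), and a coboundary pulls back to a coboundary.
* §2 **`layerLocOf_eq_zero_of_localization_shapiroLift_eq_zero`**: `loc_v (Sh c) = 0 ⟹ layerLocOf … κ v n c = 0` (§1 with (E1b) of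
  `…CofreeShapiroTransport` at `σ = 1`).
* §3 the pairing corollaries: **`layerPairingOf_eq_zero_of_localization_shapiroLift_eq_zero`** (generic datum `e` on `A_ρ[N]`, any place — the
  S₀-side / AwayTwo currency) and **`rhoLayerPairingPk_eq_zero_of_localization_shapiroLift_eq_zero`** (the pinned `ρ`-coefficient layer Tate
  pairing `⟨x, ·⟩_{n,p^k}` of K-c VANISHES as soon as `loc_v (Sh (red_{p^k} x)) = 0` — the hypothesis shape of the strict readings).

References: [Kobayashi2003] (8.23) (p. 18); [SerreGaloisCohomology1997] I §2.4–2.5, §5.1; [NeukirchSchmidtWingberg2008] I §6 Prop. (1.6.4);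
[Greenberg1989] §1 p. 98 (3); [MilneADT2006] I §4.
-/

set_option autoImplicit false
-- the Theorems namespace of this sub repeats the summit name by design (D-0017 nested layout)
set_option linter.dupNamespace false

noncomputable section

open scoped Classical NumberField

namespace Summit.BirchSwinnertonDyer.BirchSwinnertonDyer.Theorems.ThetaTransport.CofreeSelmerTransfer

open CategoryTheory Field NumberField IsDedekindDomain
  Literature.NumberTheory.EllipticCurves Literature.NumberTheory.GaloisRepresentations
  Literature.NumberTheory.EllipticCurves.Kobayashi2003
  Literature.NumberTheory.EllipticCurves.GreenbergSelmer Literature.NumberTheory.EllipticCurves.CyclotomicLayer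
  Literature.NumberTheory.GaloisCohomology ZpExtension
  Literature.NumberTheory.GaloisRepresentations.DiscreteGaloisModule
  Summit.BirchSwinnertonDyer.BirchSwinnertonDyer.Theorems

variable {p : ℕ} [Fact p.Prime] (S : Set (PadicAlgCl p)) {d : ℕ} (ρ : FramedGaloisRep ℚ ↥(padicCoeffIntegers S) d)
  (κ : ZpExtension ℚ p) (v : HeightOneSpectrum (𝓞 ℚ))

/-! ## §1 Dying on `Γ_n ∩ D_v` ⟹ the layer localisation vanishes -/

/-- **`res_{Γ_n ∩ D_v} c = 0 ⟹ loc_n c = 0` in `H¹(U_n, A_ρ[N]|)`.** The layer localisation `layerLocOf` is the pullback along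
`U_n = Gal(ℚ̄_v/ℚ_{n,v}) → Γ_n`, whose image lies in `Γ_n ∩ D_v` (`D_v = GreenbergSelmer.decomp v` is the image of `Γ_{ℚ_v} → Γ_ℚ`,
`Kobayashi2003.resGalOfEmb_mem_decomp`); a cocycle that is a coboundary `x ↦ x • a − a` on `Γ_n ∩ D_v` pulls back to the coboundary of `a`
on `U_n`. [cite: SerreGaloisCohomology1997, I §2.4 and §5.1] [cite: Kobayashi2003, (8.23) (p. 18)] -/
theorem layerLocOf_eq_zero_of_resOfLe_decomp_eq_zero (N : ℤ) (n : ℕ)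
    (c : H1 (cofreeTorsionGaloisModule S ρ N) (κ.layerSubgroup n))
    (h : resOfLe ↥(AddSubgroup.torsionBy (Cofree ρ ↥(padicCoeffField S)) N)
        (inf_le_left : κ.layerSubgroup n ⊓ GreenbergSelmer.decomp v ≤ κ.layerSubgroup n)
      (c : subgroupH1 (κ.layerSubgroup n) ↥(AddSubgroup.torsionBy (Cofree ρ ↥(padicCoeffField S)) N)) = 0) :
    layerLocOf (cofreeTorsionGaloisModule S ρ N) κ v n c = 0 := by
  obtain ⟨z, rfl⟩ := oneCocycleClass_surjective (subgroupRep (cofreeTorsionGaloisModule S ρ N).toTopRep (κ.layerSubgroup n)) c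
  change resOfLe ↥(AddSubgroup.torsionBy (Cofree ρ ↥(padicCoeffField S)) N) _
    (oneCocycleClass (discreteTopRep (κ.layerSubgroup n) ↥(AddSubgroup.torsionBy (Cofree ρ ↥(padicCoeffField S)) N)) z) = 0 at h
  rw [CocycleCriteria.resOfLe_oneCocycleClass_eq_zero_iff] at h
  obtain ⟨a, ha⟩ := h
  rw [layerLocOf_oneCocycleClass, oneCocycleClass_eq_zero_iff]
  refine ⟨a, fun τ ↦ ?_⟩
  have hmem : resGalOfEmb (closureEmb (K := ℚ) (v.adicCompletion ℚ)) (τ : absoluteGaloisGroup (v.adicCompletion ℚ)) ∈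
      κ.layerSubgroup n ⊓ GreenbergSelmer.decomp v :=
    ⟨(mem_localSubgroupOfEmb_iff (κ.layerSubgroup n) _ _).1 τ.2,
      Kobayashi2003.resGalOfEmb_mem_decomp v (τ : absoluteGaloisGroup (v.adicCompletion ℚ))⟩
  have e := ha ⟨_, hmem⟩
  have e2 : Subgroup.inclusion (inf_le_left : κ.layerSubgroup n ⊓ GreenbergSelmer.decomp v ≤ κ.layerSubgroup n) ⟨_, hmem⟩ =
      resGalSubgroupOfEmb (κ.layerSubgroup n) (closureEmb (K := ℚ) (v.adicCompletion ℚ)) τ := Subtype.ext rfl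
  rw [e2] at e
  rw [contOneCocycles.pullback_apply]
  exact e

/-! ## §2 Local vanishing of the Shapiro lift ⟹ the layer localisation vanishes -/

section Shapiro

variable (N : ℤ) (n : ℕ) [Fintype (absoluteGaloisGroup ℚ ⧸ κ.layerSubgroup n)]
  {s : absoluteGaloisGroup ℚ ⧸ κ.layerSubgroup n → absoluteGaloisGroup ℚ}
  (hs : ∀ x : absoluteGaloisGroup ℚ ⧸ κ.layerSubgroup n, (s x : absoluteGaloisGroup ℚ ⧸ κ.layerSubgroup n) = x)
  (hs1 : s ((1 : absoluteGaloisGroup ℚ) : absoluteGaloisGroup ℚ ⧸ κ.layerSubgroup n) = 1)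

/-- **`loc_v (Sh c) = 0 ⟹ loc_n c = 0`** (any place `v`, any layer `n`): the vanishing of the localisation at `v` of the Shapiro lift of
`c ∈ H¹(Γ_n, A_ρ[N])` kills `c` on `Γ_n ∩ D_v` ((E1b) of `…CofreeShapiroTransport` at `σ = 1`), hence kills the layer localisation
`layerLocOf … κ v n c` (§1). [cite: NeukirchSchmidtWingberg2008, I §6 Prop. (1.6.4)] [cite: SerreGaloisCohomology1997, I §2.5] -/
theorem layerLocOf_eq_zero_of_localization_shapiroLift_eq_zero
    (c : H1 (cofreeTorsionGaloisModule S ρ N) (κ.layerSubgroup n))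
    (h0 : galoisCohomology.localization ((cofreeTorsionGaloisModule S ρ N).coind (κ.layerSubgroup n) (κ.isOpen_layerSubgroup n))
      (Sum.inr v) 1 (shapiroLift (cofreeTorsionGaloisModule S ρ N).toTopRep (κ.layerSubgroup n) (κ.isOpen_layerSubgroup n) hs hs1 c) = 0) :
    layerLocOf (cofreeTorsionGaloisModule S ρ N) κ v n c = 0 := by
  refine layerLocOf_eq_zero_of_resOfLe_decomp_eq_zero S ρ κ v N n c ?_
  have h := ShapiroTransport.resOfLe_decomp_conjH1_eq_zero_of_localization_shapiroLift_eq_zero S ρ N κ n hs hs1 v c h0 1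
  rwa [conjH1_one_holds, AddMonoidHom.id_apply] at h

/-! ## §3 The pairing corollaries -/

/-- **Every layer pairing of `c` at `v` vanishes when `loc_v (Sh c) = 0`** (generic datum `e : A_ρ[N] × A_ρ[N] → μ_N`, any place `v` — the
currency of the S₀-side / AwayTwo pins as well as of the place above `p`): `layerPairingOf … κ v n c = 0` as an additive map on
`H¹(U_n, A_ρ[N]|)`. [cite: Kobayashi2003, (8.23) (p. 18)] [cite: MilneADT2006, Ch. I §4] -/
theorem layerPairingOf_eq_zero_of_localization_shapiroLift_eq_zero (N₀ : ℕ) [NeZero N₀]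
    (e : ↥(AddSubgroup.torsionBy (Cofree ρ ↥(padicCoeffField S)) (N₀ : ℤ)) →
      ↥(AddSubgroup.torsionBy (Cofree ρ ↥(padicCoeffField S)) (N₀ : ℤ)) → AlgebraicClosure ℚ)
    (hμ : ∀ a b, e a b ^ N₀ = 1) (hadd₁ : ∀ a₁ a₂ b, e (a₁ + a₂) b = e a₁ b * e a₂ b)
    (hadd₂ : ∀ a b₁ b₂, e a (b₁ + b₂) = e a b₁ * e a b₂)
    (hgal : ∀ (σ : absoluteGaloisGroup ℚ) (a b : ↥(AddSubgroup.torsionBy (Cofree ρ ↥(padicCoeffField S)) (N₀ : ℤ))),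
      σ • e a b = e (cofreeTorsionGaloisModule S ρ _ σ a) (cofreeTorsionGaloisModule S ρ _ σ b))
    (c : H1 (cofreeTorsionGaloisModule S ρ (N₀ : ℤ)) (κ.layerSubgroup n))
    (h0 : galoisCohomology.localization ((cofreeTorsionGaloisModule S ρ (N₀ : ℤ)).coind (κ.layerSubgroup n) (κ.isOpen_layerSubgroup n))
      (Sum.inr v) 1 (shapiroLift (cofreeTorsionGaloisModule S ρ (N₀ : ℤ)).toTopRep (κ.layerSubgroup n) (κ.isOpen_layerSubgroup n) hs hs1 c) =
        0) :
    layerPairingOf (cofreeTorsionGaloisModule S ρ (N₀ : ℤ)) N₀ e hμ hadd₁ hadd₂ hgal κ v n c = 0 := by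
  refine AddMonoidHom.ext fun y ↦ ?_
  rw [layerPairingOf_apply, layerLocOf_eq_zero_of_localization_shapiroLift_eq_zero S ρ κ v (N₀ : ℤ) n hs hs1 c h0, map_zero,
    AddMonoidHom.zero_apply]

end Shapiro

section Rho

variable (W : WeierstrassCurve ℚ) [W.IsElliptic] {r : ℕ}
  (ePk : ∀ k : ℕ, ↥(AddSubgroup.torsionBy (Cofree ρ ↥(padicCoeffField S)) ((p ^ k : ℕ) : ℤ)) →
    ↥(AddSubgroup.torsionBy (Cofree ρ ↥(padicCoeffField S)) ((p ^ k : ℕ) : ℤ)) → AlgebraicClosure ℚ)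
  (hμPk : ∀ k a b, ePk k a b ^ (p ^ k) = 1)
  (hadd₁Pk : ∀ k a₁ a₂ b, ePk k (a₁ + a₂) b = ePk k a₁ b * ePk k a₂ b)
  (hadd₂Pk : ∀ k a b₁ b₂, ePk k a (b₁ + b₂) = ePk k a b₁ * ePk k a b₂)
  (hgalPk : ∀ k (σ : absoluteGaloisGroup ℚ) (a b : ↥(AddSubgroup.torsionBy (Cofree ρ ↥(padicCoeffField S)) ((p ^ k : ℕ) : ℤ))),
    σ • ePk k a b = ePk k (cofreeTorsionGaloisModule S ρ _ σ a) (cofreeTorsionGaloisModule S ρ _ σ b))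
  (Θ : Cofree ρ ↥(padicCoeffField S) ≃+ (Fin r → ↥(W.geomPrimaryTorsion p)))
  (hΘ : ∀ (δ : absoluteGaloisGroup (v.adicCompletion ℚ)) (m : Cofree ρ ↥(padicCoeffField S)) (i : Fin r),
    Θ (resGalOfEmb (closureEmb (K := ℚ) (v.adicCompletion ℚ)) δ • m) i =
      resGalOfEmb (closureEmb (K := ℚ) (v.adicCompletion ℚ)) δ • Θ m i)
  (n k : ℕ) [Fintype (absoluteGaloisGroup ℚ ⧸ κ.layerSubgroup n)]
  {s : absoluteGaloisGroup ℚ ⧸ κ.layerSubgroup n → absoluteGaloisGroup ℚ}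
  (hs : ∀ x : absoluteGaloisGroup ℚ ⧸ κ.layerSubgroup n, (s x : absoluteGaloisGroup ℚ ⧸ κ.layerSubgroup n) = x)
  (hs1 : s ((1 : absoluteGaloisGroup ℚ) : absoluteGaloisGroup ℚ ⧸ κ.layerSubgroup n) = 1)

include hs hs1 in
/-- **The pinned `ρ`-coefficient layer Tate pairing VANISHES on a class strict at `v`**: if the Shapiro lift of the reduction
`red_{p^k} x ∈ H¹(Γ_n, A_ρ[p^k])` of a Kato-side class `x ∈ H¹(Γ_n, T_ρ)` has `loc_v (Sh (red_{p^k} x)) = 0`, then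
`rhoLayerPairingPk … n k x = 0` — i.e. `⟨x, Q⟩_{n,p^k} = 0` for every tuple `Q` of layer points (K-c's currency; with `x := I.proj n x'` this is
the hypothesis shape of the strict (`z = 0`) readings of the value transfer, p692412). [cite: Kobayashi2003, (8.23) (p. 18)]
[cite: Greenberg1989, §1 p. 98] -/
theorem rhoLayerPairingPk_eq_zero_of_localization_shapiroLift_eq_zero
    (x : H1 (FramedGaloisRep.toGaloisRep ρ) (κ.layerSubgroup n))
    (h0 : galoisCohomology.localization
        ((cofreeTorsionGaloisModule S ρ ((p ^ k : ℕ) : ℤ)).coind (κ.layerSubgroup n) (κ.isOpen_layerSubgroup n)) (Sum.inr v) 1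
        (shapiroLift (cofreeTorsionGaloisModule S ρ ((p ^ k : ℕ) : ℤ)).toTopRep (κ.layerSubgroup n) (κ.isOpen_layerSubgroup n) hs hs1
          (reduceH1CofreePkTorsion S ρ k (κ.layerSubgroup n) x)) = 0) :
    rhoLayerPairingPk S ρ W ePk hμPk hadd₁Pk hadd₂Pk hgalPk Θ κ v hΘ n k x = 0 := by
  refine AddMonoidHom.ext fun Q ↦ ?_
  rw [rhoLayerPairingPk_apply, layerLocOf_eq_zero_of_localization_shapiroLift_eq_zero S ρ κ v ((p ^ k : ℕ) : ℤ) n hs hs1 _ h0, map_zero,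
    AddMonoidHom.zero_apply, AddMonoidHom.zero_apply]

end Rho

/-! ## §4 The same for every CONJUGATE (the coset representatives `rep c` of the AwayTwo frame) -/

section Conj

variable (N : ℤ) (n : ℕ) [Fintype (absoluteGaloisGroup ℚ ⧸ κ.layerSubgroup n)]
  {s : absoluteGaloisGroup ℚ ⧸ κ.layerSubgroup n → absoluteGaloisGroup ℚ}
  (hs : ∀ x : absoluteGaloisGroup ℚ ⧸ κ.layerSubgroup n, (s x : absoluteGaloisGroup ℚ ⧸ κ.layerSubgroup n) = x)
  (hs1 : s ((1 : absoluteGaloisGroup ℚ) : absoluteGaloisGroup ℚ ⧸ κ.layerSubgroup n) = 1)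

/-- **`loc_v (Sh c) = 0 ⟹ loc_n (conj_σ c) = 0` for EVERY `σ ∈ Γ_ℚ`** (the frame's coset representatives `rep c`, AWAYTWO-FRAME-g18 §1–§2:
the S₀-side pins read `layerLocOf … κ w n (conj (rep c) c')`). (E1b) of `…CofreeShapiroTransport` kills every conjugate of `c` on
`Γ_n ∩ D_v`; then §1. [cite: NeukirchSchmidtWingberg2008, I §6 Prop. (1.6.4)] [cite: SerreGaloisCohomology1997, I §2.5] -/
theorem layerLocOf_conjH1_eq_zero_of_localization_shapiroLift_eq_zero
    (c : H1 (cofreeTorsionGaloisModule S ρ N) (κ.layerSubgroup n))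
    (h0 : galoisCohomology.localization ((cofreeTorsionGaloisModule S ρ N).coind (κ.layerSubgroup n) (κ.isOpen_layerSubgroup n))
      (Sum.inr v) 1 (shapiroLift (cofreeTorsionGaloisModule S ρ N).toTopRep (κ.layerSubgroup n) (κ.isOpen_layerSubgroup n) hs hs1 c) = 0)
    (σ : absoluteGaloisGroup ℚ) :
    layerLocOf (cofreeTorsionGaloisModule S ρ N) κ v n
      (conjH1 (κ.layerSubgroup n) ↥(AddSubgroup.torsionBy (Cofree ρ ↥(padicCoeffField S)) N) σ
        (c : subgroupH1 (κ.layerSubgroup n) ↥(AddSubgroup.torsionBy (Cofree ρ ↥(padicCoeffField S)) N))) = 0 :=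
  layerLocOf_eq_zero_of_resOfLe_decomp_eq_zero S ρ κ v N n _
    (ShapiroTransport.resOfLe_decomp_conjH1_eq_zero_of_localization_shapiroLift_eq_zero S ρ N κ n hs hs1 v c h0 σ)

/-- **Every layer pairing of every CONJUGATE of `c` at `v` vanishes when `loc_v (Sh c) = 0`** (generic datum `e`).
[cite: Kobayashi2003, (8.23) (p. 18)] [cite: MilneADT2006, Ch. I §4] -/
theorem layerPairingOf_conjH1_eq_zero_of_localization_shapiroLift_eq_zero (N₀ : ℕ) [NeZero N₀]
    (e : ↥(AddSubgroup.torsionBy (Cofree ρ ↥(padicCoeffField S)) (N₀ : ℤ)) →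
      ↥(AddSubgroup.torsionBy (Cofree ρ ↥(padicCoeffField S)) (N₀ : ℤ)) → AlgebraicClosure ℚ)
    (hμ : ∀ a b, e a b ^ N₀ = 1) (hadd₁ : ∀ a₁ a₂ b, e (a₁ + a₂) b = e a₁ b * e a₂ b)
    (hadd₂ : ∀ a b₁ b₂, e a (b₁ + b₂) = e a b₁ * e a b₂)
    (hgal : ∀ (σ : absoluteGaloisGroup ℚ) (a b : ↥(AddSubgroup.torsionBy (Cofree ρ ↥(padicCoeffField S)) (N₀ : ℤ))),
      σ • e a b = e (cofreeTorsionGaloisModule S ρ _ σ a) (cofreeTorsionGaloisModule S ρ _ σ b))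
    (c : H1 (cofreeTorsionGaloisModule S ρ (N₀ : ℤ)) (κ.layerSubgroup n))
    (h0 : galoisCohomology.localization ((cofreeTorsionGaloisModule S ρ (N₀ : ℤ)).coind (κ.layerSubgroup n) (κ.isOpen_layerSubgroup n))
      (Sum.inr v) 1 (shapiroLift (cofreeTorsionGaloisModule S ρ (N₀ : ℤ)).toTopRep (κ.layerSubgroup n) (κ.isOpen_layerSubgroup n) hs hs1 c) =
        0)
    (σ : absoluteGaloisGroup ℚ) :
    layerPairingOf (cofreeTorsionGaloisModule S ρ (N₀ : ℤ)) N₀ e hμ hadd₁ hadd₂ hgal κ v n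
      (conjH1 (κ.layerSubgroup n) ↥(AddSubgroup.torsionBy (Cofree ρ ↥(padicCoeffField S)) (N₀ : ℤ)) σ
        (c : subgroupH1 (κ.layerSubgroup n) ↥(AddSubgroup.torsionBy (Cofree ρ ↥(padicCoeffField S)) (N₀ : ℤ)))) = 0 := by
  refine AddMonoidHom.ext fun y ↦ ?_
  rw [layerPairingOf_apply, layerLocOf_conjH1_eq_zero_of_localization_shapiroLift_eq_zero S ρ κ v (N₀ : ℤ) n hs hs1 c h0 σ, map_zero,
    AddMonoidHom.zero_apply]

end Conj

end Summit.BirchSwinnertonDyer.BirchSwinnertonDyer.Theorems.ThetaTransport.CofreeSelmerTransfer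

end
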